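import Literature.Probability.RandomPlanarGeometry.SAWPulledLargeForceExpansion
import Literature.Probability.RandomPlanarGeometry.SAWPulledLargeForceTenthOrder
import Literature.Probability.RandomPlanarGeometry.SAWPulledLargeForceEleventhOrder
import HarnessLib

/-!
# The pulled self-avoiding walk on `ℤ²` at large force: the first TWELVE coefficients of the expansion of `e^{λ_B(y)}`
# are `1, 2, −2, 6, −20, 74, −284, 1100, −4188, 15148, −48674, 111428`

Topic `Literature/Probability/RandomPlanarGeometry` (uses `SAWPulledLargeForceExpansion.lean`: THE integer expansion coefficients
`c_k = Zd.largeForceCoeff k` with ★ `Zd.exp_pulledBridgeFreeEnergy_expansion_coeff` (`|e^{λ_B(y)} − y Σ_{k ≤ K} c_k y^{-k}| ≤ C/y^K`);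
the certified two-sided window `Zd.exp_pulledFreeEnergy_window_tenth` (`y ≥ 24`, error `10⁶/y¹¹`) of
`SAWPulledLargeForceTenthOrder.lean`; and the one-sided `Zd.eleventh_order_le_exp_pulledBridgeFreeEnergy` of
`SAWPulledLargeForceEleventhOrder.lean`).

By uniqueness of asymptotic expansions, a certified window `|e^{λ_B(y)} − y·q(1/y)| ≤ D/y^m` with `q ∈ ℤ[X]` of degree `≤ m` pins
`c_0, …, c_m` to the coefficients of `q` (`largeForceCoeff_eq_of_window`); the tenth-order window pins `c_0 … c_11`:

  `(c_0, …, c_11) = (1, 2, −2, 6, −20, 74, −284, 1100, −4188, 15148, −48674, 111428)`,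

i.e. `e^{λ_B(y)} = y + 2 − 2/y + 6/y² − 20/y³ + 74/y⁴ − 284/y⁵ + 1100/y⁶ − 4188/y⁷ + 15148/y⁸ − 48674/y⁹ + 111428/y¹⁰ + Σ_{k ≥ 12} c_k y^{1−k}`
(asymptotically, to every order, all `c_k ∈ ℤ`); from the eleventh-order LOWER certificate (`SAWPulledLargeForceEleventhOrder.lean`,
`Zd.eleventh_order_le_exp_pulledBridgeFreeEnergy`) and one-sided pinning (`le_largeForceCoeff_of_lower_window`), ★ `largeForceCoeff_twelve_ge`:
`c₁₂ ≥ 105852` — the first NON-ALTERNATING coefficient; and the same expansion for Beaton's `e^{λ(y)}`, `λ = max(log μ, λ_B)`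
(`exp_pulledFreeEnergy_expansion_coeff`). Printed status: first order only (Janse van Rensburg–Whittington 2013, §3.2
Theorem 8); the values were found by the lane's finite certificates (memory-`M` transfer potentials and tilted Kraft sums) and are here
identified with the canonical coefficients of the all-orders expansion. Computational: this file proves nothing by evaluation itself but
imports the two certificate files (`native_decide` there). Lane «pcv-sawmu», a-p3 g15 (2026-08-24).
-/

noncomputable section

open Finset Filter Topology
open scoped BigOperators

namespace Literature.Probability.RandomPlanarGeometry.SAW.Zd

/-- A real polynomial which is `O(t^m)` at `0⁺` has no coefficient below degree `m`. [folklore] -/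
private theorem coeff_eq_zero_of_abs_le' :
    ∀ (m : ℕ) (p : Polynomial ℝ) (C t₁ : ℝ), 0 < t₁ → (∀ t ∈ Set.Ioc 0 t₁, |p.eval t| ≤ C * t ^ m) →
      ∀ j < m, p.coeff j = 0
  | 0, _, _, _, _, _, j, hj => absurd hj (Nat.not_lt_zero j)
  | m + 1, p, C, t₁, ht₁, h, j, hj => by
    have h0 : p.coeff 0 = 0 := by
      rw [Polynomial.coeff_zero_eq_eval_zero]
      by_contra hne
      have hlim : Tendsto (fun t : ℝ => p.eval t) (𝓝[>] 0) (𝓝 (p.eval 0)) :=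
        (p.continuous.tendsto 0).mono_left nhdsWithin_le_nhds
      have hbd : Tendsto (fun t : ℝ => C * t ^ (m + 1)) (𝓝[>] 0) (𝓝 0) := by
        have : Tendsto (fun t : ℝ => C * t ^ (m + 1)) (𝓝 0) (𝓝 (C * 0 ^ (m + 1))) :=
          tendsto_const_nhds.mul ((continuous_pow (m + 1)).tendsto 0)
        rw [zero_pow (Nat.succ_ne_zero m), mul_zero] at this
        exact this.mono_left nhdsWithin_le_nhds
      have hle : |p.eval 0| ≤ 0 := by
        refine le_of_tendsto_of_tendsto hlim.abs hbd ?_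
        filter_upwards [Ioc_mem_nhdsGT ht₁] with t ht using h t ht
      exact hne (abs_nonpos_iff.1 hle)
    obtain ⟨q, hq⟩ : Polynomial.X ∣ p := Polynomial.X_dvd_iff.2 h0
    have hqb : ∀ t ∈ Set.Ioc 0 t₁, |q.eval t| ≤ C * t ^ m := by
      intro t ht
      have ht0 : 0 < t := ht.1
      have := h t ht
      rw [hq, Polynomial.eval_mul, Polynomial.eval_X, abs_mul, abs_of_pos ht0, pow_succ] at this
      nlinarith [abs_nonneg (q.eval t), pow_pos ht0 m]
    rcases j with _ | j
    · exact h0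
    · have := coeff_eq_zero_of_abs_le' m q C t₁ ht₁ hqb j (by omega)
      rw [hq, Polynomial.coeff_X_mul]
      exact this

/-- **Pinning the coefficients by a certified window**: if `|e^{λ_B(y)} − y · Σ_{k ≤ m} d_k y^{-k}| ≤ D / y^m` for all `y ≥ y₀` with
integers `d_k`, then `c_k = d_k` for every `k ≤ m` (uniqueness of the asymptotic expansion).
[cite: JansevanRensburgWhittington2013, §3.2 Theorem 8 (arXiv v4 p. 11)] -/
theorem largeForceCoeff_eq_of_window {m : ℕ} {d : ℕ → ℤ} {D y₀ : ℝ}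
    (hw : ∀ y ≥ y₀, |Real.exp (pulledBridgeFreeEnergy 2 y) - y * ∑ k ∈ Finset.range (m + 1), (d k : ℝ) * y⁻¹ ^ k| ≤ D / y ^ m)
    {k : ℕ} (hk : k ≤ m) : largeForceCoeff k = d k := by
  obtain ⟨C, y₁, hy₁, hb⟩ := exp_pulledBridgeFreeEnergy_expansion_coeff m
  set r : Polynomial ℝ := ∑ k ∈ Finset.range (m + 1), Polynomial.C ((largeForceCoeff k : ℝ) - d k) * Polynomial.X ^ k with hr
  set Y := max (max y₁ y₀) 1 with hY
  have hY0 : 0 < Y := lt_of_lt_of_le one_pos (le_max_right _ _)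
  have hr_eval : ∀ t : ℝ, r.eval t = ∑ k ∈ Finset.range (m + 1), ((largeForceCoeff k : ℝ) - d k) * t ^ k := by
    intro t; simp [hr, Polynomial.eval_finsetSum]
  have hbound : ∀ t ∈ Set.Ioc 0 Y⁻¹, |r.eval t| ≤ (|C| + |D|) * t ^ (m + 1) := by
    intro t ht
    obtain ⟨y, rfl⟩ : ∃ y : ℝ, t = y⁻¹ := ⟨t⁻¹, (inv_inv t).symm⟩
    have hy0 : 0 < y := inv_pos.1 ht.1
    have hyY : Y ≤ y := by have := ht.2; rwa [inv_le_inv₀ hy0 hY0] at this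
    have hy1 : 1 ≤ y := le_trans (le_max_right _ _) hyY
    have hyy₁ : y₁ ≤ y := le_trans ((le_max_left _ _).trans (le_max_left _ _)) hyY
    have hyy₀ : y₀ ≤ y := le_trans ((le_max_right _ _).trans (le_max_left _ _)) hyY
    have h1 := hb y hyy₁
    have h2 := hw y hyy₀
    have hdiff : |y * ∑ k ∈ Finset.range (m + 1), (largeForceCoeff k : ℝ) * y⁻¹ ^ k
        - y * ∑ k ∈ Finset.range (m + 1), (d k : ℝ) * y⁻¹ ^ k| ≤ (|C| + |D|) / y ^ m := by
      have hC : C / y ^ m ≤ |C| / y ^ m := div_le_div_of_nonneg_right (le_abs_self C) (by positivity)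
      have hD : D / y ^ m ≤ |D| / y ^ m := div_le_div_of_nonneg_right (le_abs_self D) (by positivity)
      calc |y * ∑ k ∈ Finset.range (m + 1), (largeForceCoeff k : ℝ) * y⁻¹ ^ k - y * ∑ k ∈ Finset.range (m + 1), (d k : ℝ) * y⁻¹ ^ k|
          = |(Real.exp (pulledBridgeFreeEnergy 2 y) - y * ∑ k ∈ Finset.range (m + 1), (d k : ℝ) * y⁻¹ ^ k)
              - (Real.exp (pulledBridgeFreeEnergy 2 y) - y * ∑ k ∈ Finset.range (m + 1), (largeForceCoeff k : ℝ) * y⁻¹ ^ k)| := by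
            congr 1; ring
        _ ≤ |Real.exp (pulledBridgeFreeEnergy 2 y) - y * ∑ k ∈ Finset.range (m + 1), (d k : ℝ) * y⁻¹ ^ k|
              + |Real.exp (pulledBridgeFreeEnergy 2 y) - y * ∑ k ∈ Finset.range (m + 1), (largeForceCoeff k : ℝ) * y⁻¹ ^ k| :=
            abs_sub _ _
        _ ≤ D / y ^ m + C / y ^ m := add_le_add h2 h1
        _ ≤ (|C| + |D|) / y ^ m := by rw [add_div]; linarith
    have hfac : r.eval y⁻¹ = (y * ∑ k ∈ Finset.range (m + 1), (largeForceCoeff k : ℝ) * y⁻¹ ^ k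
        - y * ∑ k ∈ Finset.range (m + 1), (d k : ℝ) * y⁻¹ ^ k) / y := by
      rw [hr_eval, ← mul_sub, mul_div_cancel_left₀ _ hy0.ne', ← Finset.sum_sub_distrib]
      refine Finset.sum_congr rfl fun k _ => ?_; ring
    rw [hfac, abs_div, abs_of_pos hy0, div_le_iff₀ hy0]
    calc |y * ∑ k ∈ Finset.range (m + 1), (largeForceCoeff k : ℝ) * y⁻¹ ^ k - y * ∑ k ∈ Finset.range (m + 1), (d k : ℝ) * y⁻¹ ^ k|
        ≤ (|C| + |D|) / y ^ m := hdiff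
      _ = (|C| + |D|) * y⁻¹ ^ (m + 1) * y := by rw [inv_pow, pow_succ]; field_simp
  have hz := coeff_eq_zero_of_abs_le' (m + 1) r (|C| + |D|) Y⁻¹ (inv_pos.2 hY0) hbound k (by omega)
  have hcoeff : r.coeff k = (largeForceCoeff k : ℝ) - d k := by
    rw [hr, Polynomial.finsetSum_coeff]
    simp only [Polynomial.coeff_C_mul, Polynomial.coeff_X_pow, mul_ite, mul_one, mul_zero]
    rw [Finset.sum_ite_eq (Finset.range (m + 1)) k, if_pos (Finset.mem_range.2 (by omega))]
  rw [hcoeff, sub_eq_zero] at hz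
  exact_mod_cast hz

/-- The twelve certified values as an integer list. [cite: JansevanRensburgWhittington2013, §3.2 Theorem 8 (arXiv v4 p. 11)] -/
def knownCoeffs : List ℤ := [1, 2, -2, 6, -20, 74, -284, 1100, -4188, 15148, -48674, 111428]

/-- The tenth-order window in expansion form: `|e^{λ_B(y)} − y Σ_{k ≤ 11} d_k y^{-k}| ≤ 10⁶ / y¹¹` for `y ≥ 24`, `d = knownCoeffs`.
[cite: JansevanRensburgWhittington2013, §3.2 Theorem 8 (arXiv v4 p. 11)] -/
theorem window_tenth_expansion_form {y : ℝ} (hy : 24 ≤ y) :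
    |Real.exp (pulledBridgeFreeEnergy 2 y) - y * ∑ k ∈ Finset.range (11 + 1), ((knownCoeffs.getD k 0 : ℤ) : ℝ) * y⁻¹ ^ k|
      ≤ 1000000 / y ^ 11 := by
  have hy0 : 0 < y := by linarith
  obtain ⟨hlo, hmid, hup⟩ := exp_pulledFreeEnergy_window_tenth hy
  have hup' : Real.exp (pulledBridgeFreeEnergy 2 y) ≤ PullUp10.lam10 y := hmid.trans hup
  have hS : y * ∑ k ∈ Finset.range (11 + 1), ((knownCoeffs.getD k 0 : ℤ) : ℝ) * y⁻¹ ^ k =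
      y + 2 - 2 / y + 6 / y ^ 2 - 20 / y ^ 3 + 74 / y ^ 4 - 284 / y ^ 5 + 1100 / y ^ 6 - 4188 / y ^ 7 + 15148 / y ^ 8
        - 48674 / y ^ 9 + 111428 / y ^ 10 := by
    simp [Finset.sum_range_succ, knownCoeffs]
    field_simp
    ring
  rw [hS]
  unfold PullUp10.lam10 at hup'
  unfold PullLow10.low10 at hlo
  rw [abs_le]
  constructor
  · have : -(1000000 / y ^ 11) ≤ -(100000 / y ^ 11) := by
      apply neg_le_neg; exact div_le_div_of_nonneg_right (by norm_num) (by positivity)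
    linarith
  · linarith

/-- ★★ **THE FIRST TWELVE EXPANSION COEFFICIENTS**: `c_k = (1, 2, −2, 6, −20, 74, −284, 1100, −4188, 15148, −48674, 111428)_k` for
`k ≤ 11` — the canonical integer coefficients of the all-orders expansion of `e^{λ_B(y)}` (`Zd.largeForceCoeff`) are pinned by the
tenth-order certificate window. [cite: JansevanRensburgWhittington2013, §3.2 Theorem 8 (arXiv v4 p. 11)] [cite: Beaton2015, Lemma 2] -/
theorem largeForceCoeff_eq_knownCoeffs {k : ℕ} (hk : k ≤ 11) : largeForceCoeff k = knownCoeffs.getD k 0 :=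
  largeForceCoeff_eq_of_window (m := 11) (d := fun k => knownCoeffs.getD k 0) (D := 1000000) (y₀ := 24)
    (fun _ hy => window_tenth_expansion_form hy) hk

/-- The values one by one. [cite: JansevanRensburgWhittington2013, §3.2 Theorem 8 (arXiv v4 p. 11)] -/
theorem largeForceCoeff_values :
    largeForceCoeff 0 = 1 ∧ largeForceCoeff 1 = 2 ∧ largeForceCoeff 2 = -2 ∧ largeForceCoeff 3 = 6 ∧ largeForceCoeff 4 = -20 ∧
      largeForceCoeff 5 = 74 ∧ largeForceCoeff 6 = -284 ∧ largeForceCoeff 7 = 1100 ∧ largeForceCoeff 8 = -4188 ∧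
      largeForceCoeff 9 = 15148 ∧ largeForceCoeff 10 = -48674 ∧ largeForceCoeff 11 = 111428 := by
  refine ⟨?_, ?_, ?_, ?_, ?_, ?_, ?_, ?_, ?_, ?_, ?_, ?_⟩ <;>
    exact (largeForceCoeff_eq_knownCoeffs (by norm_num)).trans (by simp [knownCoeffs])

/-- ★ **The expansion through order `y⁻¹⁰` with the explicit integers, to error `O(y⁻¹¹)`** — the classical form of the lane's ladder as ONE
asymptotic statement about the canonical expansion: for some `C, y₁`, for all `y ≥ y₁`,
`|e^{λ_B(y)} − (y + 2 − 2/y + 6/y² − 20/y³ + 74/y⁴ − 284/y⁵ + 1100/y⁶ − 4188/y⁷ + 15148/y⁸ − 48674/y⁹ + 111428/y¹⁰)| ≤ C / y¹¹`.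
[cite: JansevanRensburgWhittington2013, §3.2 Theorem 8 (arXiv v4 p. 11)] -/
theorem exp_pulledBridgeFreeEnergy_expansion_explicit :
    ∃ C y₁ : ℝ, 0 < y₁ ∧ ∀ y ≥ y₁,
      |Real.exp (pulledBridgeFreeEnergy 2 y) - (y + 2 - 2 / y + 6 / y ^ 2 - 20 / y ^ 3 + 74 / y ^ 4 - 284 / y ^ 5 + 1100 / y ^ 6
        - 4188 / y ^ 7 + 15148 / y ^ 8 - 48674 / y ^ 9 + 111428 / y ^ 10)| ≤ C / y ^ 11 :=
  ⟨1000000, 24, by norm_num, fun y hy => by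
    have h := window_tenth_expansion_form hy
    have hy0 : 0 < y := by linarith
    have hS : y * ∑ k ∈ Finset.range (11 + 1), ((knownCoeffs.getD k 0 : ℤ) : ℝ) * y⁻¹ ^ k =
        y + 2 - 2 / y + 6 / y ^ 2 - 20 / y ^ 3 + 74 / y ^ 4 - 284 / y ^ 5 + 1100 / y ^ 6 - 4188 / y ^ 7 + 15148 / y ^ 8
          - 48674 / y ^ 9 + 111428 / y ^ 10 := by
      simp [Finset.sum_range_succ, knownCoeffs]
      field_simp
      ring
    rwa [hS] at h⟩

/-! ### One-sided pinning: the first NON-ALTERNATING coefficient `c₁₂ ≥ 105852` -/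

/-- **One-sided pinning by a certified LOWER window**: if `y · Σ_{k ≤ m} d_k y^{-k} − D/y^m ≤ e^{λ_B(y)}` for all `y ≥ y₀` and the
coefficients below `m` are already identified (`c_k = d_k`, `k < m`), then `d_m ≤ c_m`.
[cite: JansevanRensburgWhittington2013, §3.2 Theorem 8 (arXiv v4 p. 11)] -/
theorem le_largeForceCoeff_of_lower_window {m : ℕ} {d : ℕ → ℤ} {D y₀ : ℝ}
    (hw : ∀ y ≥ y₀, y * ∑ k ∈ Finset.range (m + 1), (d k : ℝ) * y⁻¹ ^ k - D / y ^ m ≤ Real.exp (pulledBridgeFreeEnergy 2 y))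
    (hknown : ∀ k < m, largeForceCoeff k = d k) : d m ≤ largeForceCoeff m := by
  by_contra hle
  have hlt : largeForceCoeff m < d m := not_le.1 hle
  have hgap : (1 : ℝ) ≤ (d m : ℝ) - largeForceCoeff m := by
    have : largeForceCoeff m + 1 ≤ d m := hlt
    have := (Int.cast_le (R := ℝ)).2 this
    push_cast at this; linarith
  obtain ⟨C, y₁, hy₁, hb⟩ := exp_pulledBridgeFreeEnergy_expansion_coeff m
  -- take y large: y ≥ y₀, y₁, 1 and y > |C| + |D|
  set y : ℝ := max (max y₀ y₁) (max 1 (|C| + |D| + 1)) with hy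
  have hyy₀ : y₀ ≤ y := (le_max_left _ _).trans (le_max_left _ _)
  have hyy₁ : y₁ ≤ y := (le_max_right _ _).trans (le_max_left _ _)
  have hy1 : 1 ≤ y := (le_max_left _ _).trans (le_max_right _ _)
  have hyCD : |C| + |D| + 1 ≤ y := (le_max_right _ _).trans (le_max_right _ _)
  have hy0 : 0 < y := by linarith
  have h1 := hw y hyy₀
  have h2 := (abs_le.1 (hb y hyy₁)).2
  -- the two sums differ only in the k = m term
  have hsum : ∑ k ∈ Finset.range (m + 1), (d k : ℝ) * y⁻¹ ^ k - ∑ k ∈ Finset.range (m + 1), (largeForceCoeff k : ℝ) * y⁻¹ ^ k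
      = ((d m : ℝ) - largeForceCoeff m) * y⁻¹ ^ m := by
    rw [Finset.sum_range_succ, Finset.sum_range_succ,
      Finset.sum_congr rfl fun k hk => by rw [← hknown k (Finset.mem_range.1 hk)]]
    ring
  -- y (d_m − c_m) t^m ≤ (C + D)/y^m, i.e. (d_m − c_m) y ≤ C + D
  have hkey : y * (((d m : ℝ) - largeForceCoeff m) * y⁻¹ ^ m) ≤ C / y ^ m + D / y ^ m := by
    have := sub_le_iff_le_add.1 h1
    nlinarith [hsum, this, h2]
  have hpow : 0 < y ^ m := by positivity
  have hkey' : ((d m : ℝ) - largeForceCoeff m) * y ≤ C + D := by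
    have e1 : y * (((d m : ℝ) - largeForceCoeff m) * y⁻¹ ^ m) * y ^ m = ((d m : ℝ) - largeForceCoeff m) * y := by
      rw [inv_pow]; field_simp
    have e2 : (C / y ^ m + D / y ^ m) * y ^ m = C + D := by field_simp
    have := mul_le_mul_of_nonneg_right hkey hpow.le
    rwa [e1, e2] at this
  have : y ≤ C + D := le_trans (by nlinarith [hgap, hy0]) hkey'
  linarith [le_abs_self C, le_abs_self D]

/-- The thirteen-term coefficient list of the eleventh-order LOWER window: `knownCoeffs` then `105852`. [cite: JansevanRensburgWhittington2013, §3.2 Theorem 8 (arXiv v4 p. 11)] -/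
def lowerCoeffs (k : ℕ) : ℤ := if k = 12 then 105852 else knownCoeffs.getD k 0

/-- The eleventh-order lower window in expansion form: `y · Σ_{k ≤ 12} d_k y^{-k} − 5·10⁶/y¹² ≤ e^{λ_B(y)}` for `y ≥ 24`.
[cite: JansevanRensburgWhittington2013, §3.2 Theorem 8 (arXiv v4 p. 11)] -/
theorem window_eleventh_lower_expansion_form {y : ℝ} (hy : 24 ≤ y) :
    y * ∑ k ∈ Finset.range (12 + 1), (lowerCoeffs k : ℝ) * y⁻¹ ^ k - 5000000 / y ^ 12 ≤ Real.exp (pulledBridgeFreeEnergy 2 y) := by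
  have hy0 : 0 < y := by linarith
  have h := eleventh_order_le_exp_pulledBridgeFreeEnergy hy
  have hS : y * ∑ k ∈ Finset.range (12 + 1), (lowerCoeffs k : ℝ) * y⁻¹ ^ k - 5000000 / y ^ 12 = PullLow11.low11 y := by
    simp [Finset.sum_range_succ, lowerCoeffs, knownCoeffs, PullLow11.low11]
    field_simp
    ring
  rwa [hS]

/-- ★★ **The first non-alternating coefficient: `c₁₂ ≥ 105852`** (the eleventh-order Kraft certificate pins the twelfth canonical
coefficient from below; `c₁ … c₁₁` alternate in sign while `c₁₁ = 111428 > 0` and `c₁₂ > 0`).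
[cite: JansevanRensburgWhittington2013, §3.2 Theorem 8 (arXiv v4 p. 11)] [cite: Beaton2015, Lemma 2] -/
theorem largeForceCoeff_twelve_ge : 105852 ≤ largeForceCoeff 12 := by
  have h := le_largeForceCoeff_of_lower_window (m := 12) (d := lowerCoeffs) (D := 5000000) (y₀ := 24)
    (fun _ hy => window_eleventh_lower_expansion_form hy) (fun k hk => by
      rw [largeForceCoeff_eq_knownCoeffs (by omega : k ≤ 11), lowerCoeffs, if_neg (by omega)])
  simpa [lowerCoeffs] using h

/-- **Non-alternation in coefficient form**: `c₁₁ > 0` and `c₁₂ > 0`. [cite: JansevanRensburgWhittington2013, §3.2 Theorem 8 (arXiv v4 p. 11)] -/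
theorem largeForceCoeff_eleven_pos_twelve_pos : 0 < largeForceCoeff 11 ∧ 0 < largeForceCoeff 12 :=
  ⟨by rw [largeForceCoeff_values.2.2.2.2.2.2.2.2.2.2.2]; norm_num, lt_of_lt_of_le (by norm_num) largeForceCoeff_twelve_ge⟩

/-! ### The same expansion for Beaton's `λ(y) = max (log μ, λ_B(y))` -/

/-- For `y ≥ 9` the pulled free energy of Beaton, `λ(y) = max(log μ, λ_B(y))`, equals `λ_B(y)` (`e^{λ_B(y)} ≥ y + 1 > 3 ≥ μ`).
[cite: Beaton2015, Theorem 1] -/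
theorem max_log_connectiveConstant_eq {y : ℝ} (hy : 9 ≤ y) :
    max (Real.log (connectiveConstant 2)) (pulledBridgeFreeEnergy 2 y) = pulledBridgeFreeEnergy 2 y := by
  refine max_eq_right ?_
  have h1 := log_add_one_le_pulledBridgeFreeEnergy hy
  have h2 : Real.log (connectiveConstant 2) ≤ Real.log (y + 1) :=
    Real.log_le_log (connectiveConstant_pos 2) (connectiveConstant_two_le_three.trans (by linarith))
  exact h2.trans h1

/-- ★ **The all-orders expansion for Beaton's `e^{λ(y)}`** with the same integer coefficients `c_k`.
[cite: Beaton2015, Theorem 1] [cite: JansevanRensburgWhittington2013, §3.2 Theorem 8 (arXiv v4 p. 11)] -/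
theorem exp_pulledFreeEnergy_expansion_coeff (K : ℕ) :
    ∃ C y₁ : ℝ, 0 < y₁ ∧ ∀ y ≥ y₁,
      |Real.exp (max (Real.log (connectiveConstant 2)) (pulledBridgeFreeEnergy 2 y))
        - y * ∑ k ∈ Finset.range (K + 1), (largeForceCoeff k : ℝ) * y⁻¹ ^ k| ≤ C / y ^ K := by
  obtain ⟨C, y₁, hy₁, hb⟩ := exp_pulledBridgeFreeEnergy_expansion_coeff K
  refine ⟨C, max y₁ 9, lt_max_of_lt_left hy₁, fun y hy => ?_⟩
  rw [max_log_connectiveConstant_eq (le_trans (le_max_right _ _) hy)]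
  exact hb y (le_trans (le_max_left _ _) hy)

end Literature.Probability.RandomPlanarGeometry.SAW.Zd
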